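import Literature.Computability.Complexity.DiscreteTomographyProofs
import Literature.Barriers.ValiantsHypothesis.KroneckerPositivityHardnessProofs
import HarnessLib

/-!
# From composition codes to partition codes: the string level of Fischer–Ikenmeyer's Lemma 4
# ("if `λ` is a partition, the reduction outputs `(λ, n)`"), in `FP`

N. Fischer, C. Ikenmeyer, *The computational complexity of plethysm coefficients*, Comput.
Complexity 29 (2020) 8, Lemma 4 (proof): "Given an instance `(λ, n)` of
PROMISE-SYMMETRIC-3D-X-RAY, if `λ` is not a partition or if `|λ| ≠ 3n`, then the reduction outputs
that trivial no-instance … if `λ` is a partition, then the reduction outputs its input `(λ, n)`."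

The tomography languages of `DiscreteTomography.lean` code a composition `λ ∈ ℕ^{[0,r]}` as
`⟨1^{r+1}, ⟨1^{λ_0}, ⟨1^{λ_1}, … ⟩⟩⟩` (`encodingComposition`), whereas the plethysm languages of the
barrier file `KroneckerPositivityHardness.lean` code an instance `(λ, n)` as
`encodePartition λ ++ unaryNat n` (`unaryList` of the parts, then `1ⁿ 0`). This file supplies the
polynomial-time conversion between the two codings, by brick algebra only (no machine is written),
on composition codes `w = encode λ`:

* `usumF w = 1^{|λ|}` (a concatenation fold of the items), `thirdF w = 1^{|λ|/3 + 1}` if `3 ∣ |λ|` and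
  `ε` otherwise (a search fold comparing `1^{3q}` with `1^{|λ|}`), hence the one-bit test `div3T` and
  `nF w = 1^{|λ|/3}`;
* `antiT w = [λ_0 ≥ λ_1 ≥ ⋯ ≥ λ_r]` (a fold of adjacent comparisons);
* `codeMuF w = unaryList (λ without its zero entries)` — for weakly decreasing `λ` this is
  `encodePartition` of the partition with parts `λ`;
* **`convF`** `= iteFn (div3T ∧ antiT) (codeMuF ++ nF ++ 0) ε` and its value `convF_encode`:
  `encodePartition`-style code `unaryList (λ.filter (· ≠ 0)) ++ unaryNat (|λ|/3)` when `3 ∣ |λ|` and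
  `λ` is weakly decreasing, the empty word otherwise.

Composed with the tree's reduction `Tomography.redFn` of FI Lemma 5 (`DiscreteTomographyProofs.lean`)
this is the string level of the reductions (SKEW-)SYMMETRIC-2D-X-RAY `≤ₚ` (word-model plethysm
languages) of `PlethysmHardnessThree.lean`.

## References

* [FischerIkenmeyer2020] §6, Lemma 4 (proof) and Lemma 5 (proof); §3 (unary encodings).
* [AroraBarak2009] §1.3 (closure of polynomial time under composition and bounded loops).
-/

noncomputable section

namespace Literature.Barriers.ValiantsHypothesis

open Literature.Computability.Complexity Literature.Computability.Complexity.Tomography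
open _root_.Computability Polynomial Brick HashBricks CanonCode Plumb OracleCompose

namespace PlethCode

/-! ### A concatenation fold over the items of a composition code -/

/-- The fold skeleton: `|header|` rounds of the clipped piece over `⟨w, 1ʲ⟩`, concatenated.
[cite: AroraBarak2009, §1.3 (bounded loops)] -/
def foldW (C : ℕ) (piece : List Bool → List Bool) : List Bool → List Bool :=
  sndPow 2 ∘ foldLoop appF (clipF C piece) X ∘ initF fstF

/-- `foldW C piece ∈ FP` for `piece ∈ FP`. [cite: AroraBarak2009, §1.3] -/
theorem foldW_mem_FP {C : ℕ} {piece : List Bool → List Bool} (h : piece ∈ FP) : foldW C piece ∈ FP :=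
  comp_mem_FP (sndPow_mem_FP 2)
    (comp_mem_FP (foldLoop_clipF_mem_FP C appF_mem_FP length_appF_le h X) (initF_mem_FP fstF_mem_FP))

/-- **Value of the fold on a code**: the concatenation of the pieces at `j = 0, …, r` (when they are
short enough not to be clipped). [folklore] -/
theorem foldW_wOf {C : ℕ} {piece : List Bool → List Bool} (l : List ℕ)
    (hlen : ∀ j < l.length, (piece (boolPair (wOf l) (ones j))).length ≤ C * ((wOf l).length + 1)) :
    foldW C piece (wOf l) = ccat (fun j => piece (boolPair (wOf l) (ones j))) l.length := by
  have hk : l.length ≤ (X : Polynomial ℕ).eval (wOf l).length := by rw [eval_X]; exact length_le_length_wOf l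
  rw [foldW, Function.comp_apply, Function.comp_apply, initF_fstF_wOf, foldLoop_apply _ _ hk,
    sndPow_succ_boolPair, sndPow_succ_boolPair, sndPow_zero_boolPair, foldAcc_clipF, foldAcc_appF,
    List.nil_append]
  · exact ccat_congr fun j _ => by rw [Nat.zero_add]
  · intro j _ hj
    rw [Nat.zero_add] at hj
    exact hlen j hj

/-- `ccat` of a family is the flattened list of its values on `range K`. [folklore] -/
theorem ccat_eq_flatten (g : ℕ → List Bool) : ∀ K, ccat g K = ((List.range K).map g).flatten
  | 0 => rfl
  | K + 1 => by rw [ccat_succ, ccat_eq_flatten g K, List.range_succ, List.map_append, List.flatten_append,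
      List.map_singleton, List.flatten_singleton]

/-- A composition is the list of its entries: `(range |λ|).map λ = λ`. [folklore] -/
theorem map_listFn_range (l : List ℕ) : (List.range l.length).map (listFn l) = l := by
  apply List.ext_getElem (by simp)
  intro i h1 h2
  rw [List.getElem_map, List.getElem_range, listFn_of_lt h2]

/-! ### `|λ|` in unary and its third -/

/-- **`usumF w = 1^{|λ|}`**: the items concatenated. [cite: FischerIkenmeyer2020, §3 (unary encodings)] -/
def usumF : List Bool → List Bool := foldW 1 itemW

/-- `usumF ∈ FP`. [cite: AroraBarak2009, §1.3] -/
theorem usumF_mem_FP : usumF ∈ FP := foldW_mem_FP itemW_mem_FP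

/-- Value of `usumF` on a code. [folklore] -/
theorem usumF_wOf (l : List ℕ) : usumF (wOf l) = ones l.sum := by
  rw [usumF, foldW_wOf l]
  · rw [show (fun j => itemW (boolPair (wOf l) (ones j))) = fun j => ones (listFn l j) from
      funext (itemW_apply l), Tomography.ccat_ones, sum_eq_sum_range_listFn]
  · intro j _
    rw [itemW_apply, List.length_replicate]
    have := listFn_le_sum l j
    have := sum_le_length_wOf l
    omega

/-- The context `⟨w, 1^{|λ|}⟩` of the search fold. [folklore] -/
def ctx2F : List Bool → List Bool := fanoutFn id usumF

/-- `ctx2F ∈ FP`. [folklore] -/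
theorem ctx2F_mem_FP : ctx2F ∈ FP := fanoutFn_mem_FP id_mem_FP usumF_mem_FP

/-- `1ᵘ ↦ 1^{3u}`. [folklore] -/
def tripF : List Bool → List Bool := fun u => u ++ u ++ u

/-- `tripF ∈ FP`. [folklore] -/
theorem tripF_mem_FP : tripF ∈ FP := append_mem_FP (append_mem_FP id_mem_FP id_mem_FP) id_mem_FP

/-- The search piece at `⟨⟨w, 1^{|λ|}⟩, 1^q⟩`: `1^{q+1}` if `3q = |λ|`, else `ε`. [folklore] -/
def thirdPiece : List Bool → List Bool :=
  iteFn (eqPairFn ∘ fanoutFn (tripF ∘ sndF) (sndF ∘ fstF)) (List.cons true ∘ sndF) fun _ => []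

/-- `thirdPiece ∈ FP`. [folklore] -/
theorem thirdPiece_mem_FP : thirdPiece ∈ FP :=
  iteFn_mem_FP (comp_mem_FP eqPairFn_mem_FP (fanoutFn_mem_FP (comp_mem_FP tripF_mem_FP sndF_mem_FP)
    (comp_mem_FP sndF_mem_FP fstF_mem_FP))) (comp_mem_FP (cons_mem_FP true) sndF_mem_FP) (const_mem_FP _)

/-- Value of the search piece. [folklore] -/
theorem thirdPiece_apply (w : List Bool) (S q : ℕ) :
    thirdPiece (boolPair (boolPair w (ones S)) (ones q)) = if 3 * q = S then ones (q + 1) else [] := by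
  have hc : (eqPairFn ∘ fanoutFn (tripF ∘ sndF) (sndF ∘ fstF)) (boolPair (boolPair w (ones S)) (ones q)) =
      [decide (3 * q = S)] := by
    simp only [Function.comp_apply, fanoutFn_apply, sndF_boolPair, fstF_boolPair, tripF, eqPairFn_boolPair,
      List.replicate_append_replicate]
    have : (List.replicate (q + q + q) true = ones S) ↔ (3 * q = S) := by
      rw [ones, List.replicate_left_inj]; omega
    simp only [this]
  rw [thirdPiece, iteFn_apply hc]
  by_cases h : 3 * q = S
  · rw [decide_eq_true h, if_pos rfl, if_pos h]
    simp [ones, List.replicate_succ]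
  · rw [decide_eq_false h, if_neg h]
    simp

/-- The initial record of the search fold: `⟨⟨w, 1^{|λ|}⟩, ⟨⌜|λ|+1⌝, ⟨1⁰, ε⟩⟩⟩`. [folklore] -/
def initT : List Bool → List Bool :=
  fanoutFn ctx2F (fanoutFn (lenBinF ∘ List.cons true ∘ usumF) fun _ => boolPair (ones 0) [])

/-- `initT ∈ FP`. [folklore] -/
theorem initT_mem_FP : initT ∈ FP :=
  fanoutFn_mem_FP ctx2F_mem_FP (fanoutFn_mem_FP
    (comp_mem_FP lenBinF_mem_FP (comp_mem_FP (cons_mem_FP true) usumF_mem_FP)) (const_mem_FP _))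

/-- **`thirdF w = 1^{|λ|/3 + 1}` if `3 ∣ |λ|`, `ε` otherwise**: the search fold over `q ≤ |λ|`.
[cite: AroraBarak2009, §1.3 (bounded loops)] -/
def thirdF : List Bool → List Bool := sndPow 2 ∘ foldLoop appF (clipF 1 thirdPiece) X ∘ initT

/-- `thirdF ∈ FP`. [cite: AroraBarak2009, §1.3] -/
theorem thirdF_mem_FP : thirdF ∈ FP :=
  comp_mem_FP (sndPow_mem_FP 2)
    (comp_mem_FP (foldLoop_clipF_mem_FP 1 appF_mem_FP length_appF_le thirdPiece_mem_FP X) initT_mem_FP)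

/-- The sum of the search pieces: `|λ|/3 + 1` at the unique `q` with `3q = |λ|`, else `0`. [folklore] -/
theorem sum_search (S : ℕ) :
    (∑ q ∈ Finset.range (S + 1), if 3 * q = S then q + 1 else 0) = if 3 ∣ S then S / 3 + 1 else 0 := by
  by_cases h : 3 ∣ S
  · rw [if_pos h, Finset.sum_eq_single (S / 3)]
    · rw [if_pos (Nat.mul_div_cancel' h)]
    · intro q _ hq
      rw [if_neg]
      intro h3
      apply hq
      omega
    · intro hS
      exfalso
      apply hS
      rw [Finset.mem_range]
      omega
  · rw [if_neg h]
    refine Finset.sum_eq_zero fun q _ => ?_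
    rw [if_neg]
    intro h3
    exact h ⟨q, h3.symm⟩

/-- Value of `thirdF` on a code. [folklore] -/
theorem thirdF_wOf (l : List ℕ) : thirdF (wOf l) = if 3 ∣ l.sum then ones (l.sum / 3 + 1) else [] := by
  have hctx : ctx2F (wOf l) = boolPair (wOf l) (ones l.sum) := by
    simp [ctx2F, usumF_wOf]
  have hinit : initT (wOf l) = boolPair (boolPair (wOf l) (ones l.sum))
      (boolPair (encodeNat (l.sum + 1)) (boolPair (ones 0) [])) := by
    simp [initT, hctx, usumF_wOf, lenBinF_apply, ones]
  have hk : l.sum + 1 ≤ (X : Polynomial ℕ).eval (boolPair (wOf l) (ones l.sum)).length := by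
    rw [eval_X, length_boolPair, List.length_replicate]
    omega
  rw [thirdF, Function.comp_apply, Function.comp_apply, hinit, foldLoop_apply _ _ hk, sndPow_succ_boolPair,
    sndPow_succ_boolPair, sndPow_zero_boolPair, foldAcc_clipF, foldAcc_appF, List.nil_append]
  · have hp : (fun j => thirdPiece (boolPair (boolPair (wOf l) (ones l.sum)) (ones (0 + j)))) =
        fun j => ones (if 3 * j = l.sum then j + 1 else 0) := by
      funext j
      rw [Nat.zero_add, thirdPiece_apply]
      split_ifs <;> rfl
    rw [hp, Tomography.ccat_ones, sum_search]
    split_ifs <;> rfl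
  · intro j _ hj
    rw [thirdPiece_apply, length_boolPair, List.length_replicate]
    split_ifs
    · rw [List.length_replicate]; omega
    · simp

/-- **The divisibility test `[3 ∣ |λ|]`**. [cite: FischerIkenmeyer2020, Lemma 4 (proof: "if |λ| ≠ 3n")] -/
def div3T : List Bool → List Bool := notFn (isNilFn ∘ thirdF)

/-- `div3T ∈ FP`. [folklore] -/
theorem div3T_mem_FP : div3T ∈ FP := notFn_mem_FP (comp_mem_FP isNilFn_mem_FP thirdF_mem_FP)

/-- Value of `div3T` on a code. [folklore] -/
theorem div3T_wOf (l : List ℕ) : div3T (wOf l) = [decide (3 ∣ l.sum)] := by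
  rw [div3T, notFn_apply (b := decide (thirdF (wOf l) = []))]
  · rw [thirdF_wOf]
    by_cases h : 3 ∣ l.sum
    · rw [if_pos h, decide_eq_true h]
      simp [ones, List.replicate_succ]
    · rw [if_neg h, decide_eq_false h]
      simp
  · rfl

/-- **`nF w = 1^{|λ|/3}`** (when `3 ∣ |λ|`): drop one symbol of `thirdF w`. [folklore] -/
def nF : List Bool → List Bool := dropFn ∘ fanoutFn (fun _ => [true]) thirdF

/-- `nF ∈ FP`. [folklore] -/
theorem nF_mem_FP : nF ∈ FP := comp_mem_FP dropFn_mem_FP (fanoutFn_mem_FP (const_mem_FP _) thirdF_mem_FP)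

/-- Value of `nF` on a code with `3 ∣ |λ|`. [folklore] -/
theorem nF_wOf {l : List ℕ} (h : 3 ∣ l.sum) : nF (wOf l) = ones (l.sum / 3) := by
  rw [nF, Function.comp_apply, fanoutFn_apply, dropFn_boolPair, thirdF_wOf, if_pos h]
  simp [ones, List.replicate_succ]

/-! ### The test `λ_0 ≥ λ_1 ≥ ⋯` -/

/-- Item `j + 1` of the input, read from `⟨w, 1ʲ⟩`. [folklore] -/
def itemWS : List Bool → List Bool := nthItemFn ∘ fanoutFn (List.cons true ∘ sndF) (sndF ∘ fstF)

/-- `itemWS ∈ FP`. [folklore] -/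
theorem itemWS_mem_FP : itemWS ∈ FP :=
  comp_mem_FP nthItemFn_mem_FP (fanoutFn_mem_FP (comp_mem_FP (cons_mem_FP true) sndF_mem_FP)
    (comp_mem_FP sndF_mem_FP fstF_mem_FP))

/-- `itemWS ⟨w, 1ʲ⟩ = 1^{λ_{j+1}}`. [folklore] -/
theorem itemWS_apply (l : List ℕ) (j : ℕ) : itemWS (boolPair (wOf l) (ones j)) = ones (listFn l (j + 1)) := by
  simp only [itemWS, Function.comp_apply, fanoutFn_apply, sndF_boolPair, fstF_boolPair, wOf,
    encode_eq_boolPair_body]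
  have : true :: ones j = ones (j + 1) := by simp [ones, List.replicate_succ]
  rw [this]
  exact nthItemFn_ones_body_map l (j + 1)

/-- The violation piece `1^{[λ_j < λ_{j+1}]}`. [cite: FischerIkenmeyer2020, Lemma 4 (proof: "if λ is not a partition")] -/
def violP : List Bool → List Bool := oneIf (ltLenF ∘ fanoutFn itemW itemWS)

/-- `violP ∈ FP`. [folklore] -/
theorem violP_mem_FP : violP ∈ FP :=
  oneIf_mem_FP (comp_mem_FP ltLenF_mem_FP (fanoutFn_mem_FP itemW_mem_FP itemWS_mem_FP))

/-- Value of the violation piece. [folklore] -/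
theorem violP_apply (l : List ℕ) (j : ℕ) :
    violP (boolPair (wOf l) (ones j)) = ones (decide (listFn l j < listFn l (j + 1))).toNat := by
  rw [violP, oneIf_apply]
  rw [Function.comp_apply, fanoutFn_apply, itemW_apply, itemWS_apply, ltLenF_boolPair, List.length_replicate,
    List.length_replicate]

/-- The composition is weakly decreasing (as a finitely supported sequence). [cite: FischerIkenmeyer2020, §2 ("If the entries are nonincreasing, then we call λ a partition")] -/
def AntiL (l : List ℕ) : Prop := ∀ j < l.length, listFn l (j + 1) ≤ listFn l j

/-- `AntiL` is decidable. [folklore] -/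
instance (l : List ℕ) : Decidable (AntiL l) := inferInstanceAs (Decidable (∀ j < l.length, _))

/-- **The test `antiT w = [λ is weakly decreasing]`**. [cite: FischerIkenmeyer2020, Lemma 4 (proof)] -/
def antiT : List Bool → List Bool := isNilFn ∘ foldW 1 violP

/-- `antiT ∈ FP`. [folklore] -/
theorem antiT_mem_FP : antiT ∈ FP := comp_mem_FP isNilFn_mem_FP (foldW_mem_FP violP_mem_FP)

/-- Value of `antiT` on a code. [folklore] -/
theorem antiT_wOf (l : List ℕ) : antiT (wOf l) = [decide (AntiL l)] := by
  rw [antiT, Function.comp_apply, foldW_wOf l]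
  · have hp : (fun j => violP (boolPair (wOf l) (ones j))) =
        fun j => ones (decide (listFn l j < listFn l (j + 1))).toNat := funext (violP_apply l)
    rw [hp, Tomography.ccat_ones]
    change [decide (ones _ = [])] = _
    congr 1
    simp only [ones, List.replicate_eq_nil_iff, Finset.sum_eq_zero_iff, Finset.mem_range, AntiL,
      decide_eq_decide]
    refine forall₂_congr fun j _ => ?_
    rw [Bool.toNat_eq_zero, decide_eq_false_iff_not, not_lt]
  · intro j _
    rw [violP_apply]
    have := Bool.toNat_le (decide (listFn l j < listFn l (j + 1)))
    rw [List.length_replicate]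
    omega

/-! ### The partition code `unaryList (λ without zeros)` -/

/-- The piece of item `j`: `1^{λ_j} 0` if `λ_j ≠ 0`, else `ε`. [cite: IkenmeyerMulmuleyWalter2017, §1.1 (unary codes of partitions)] -/
def muPiece : List Bool → List Bool := iteFn (isNilFn ∘ itemW) (fun _ => []) fun z => itemW z ++ [false]

/-- `muPiece ∈ FP`. [folklore] -/
theorem muPiece_mem_FP : muPiece ∈ FP :=
  iteFn_mem_FP (comp_mem_FP isNilFn_mem_FP itemW_mem_FP) (const_mem_FP _) (append_mem_FP itemW_mem_FP (const_mem_FP _))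

/-- Value of the piece. [folklore] -/
theorem muPiece_apply (l : List ℕ) (j : ℕ) :
    muPiece (boolPair (wOf l) (ones j)) = if listFn l j = 0 then [] else unaryNat (listFn l j) := by
  have hc : (isNilFn ∘ itemW) (boolPair (wOf l) (ones j)) = [decide (listFn l j = 0)] := by
    rw [Function.comp_apply, itemW_apply]
    change [decide (ones _ = [])] = _
    simp [ones, List.replicate_eq_nil_iff]
  rw [muPiece, iteFn_apply hc]
  by_cases h : listFn l j = 0
  · rw [decide_eq_true h, if_pos rfl, if_pos h]
  · rw [decide_eq_false h, if_neg h]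
    simp [itemW_apply, unaryNat, ones]

/-- **`codeMuF w = unaryList (λ.filter (· ≠ 0))`**. [cite: IkenmeyerMulmuleyWalter2017, §1.1 (unary codes of partitions)] -/
def codeMuF : List Bool → List Bool := fun w => foldW 1 muPiece w ++ [false]

/-- `codeMuF ∈ FP`. [folklore] -/
theorem codeMuF_mem_FP : codeMuF ∈ FP := append_mem_FP (foldW_mem_FP muPiece_mem_FP) (const_mem_FP _)

/-- Flattening the pieces: `unaryList` of the nonzero entries. [folklore] -/
theorem flatten_map_ite_unaryNat (l : List ℕ) :
    (l.map fun a => if a = 0 then [] else unaryNat a).flatten = ((l.filter (· ≠ 0)).map unaryNat).flatten := by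
  induction l with
  | nil => rfl
  | cons a l ih =>
    rw [List.map_cons, List.flatten_cons, ih, List.filter_cons]
    by_cases h : a = 0
    · subst h; simp
    · simp [h]

/-- Value of `codeMuF` on a code. [folklore] -/
theorem codeMuF_wOf (l : List ℕ) : codeMuF (wOf l) = unaryList (l.filter (· ≠ 0)) := by
  rw [codeMuF, foldW_wOf l, unaryList]
  · congr 1
    have hp : (fun j => muPiece (boolPair (wOf l) (ones j))) =
        (fun a => if a = 0 then [] else unaryNat a) ∘ listFn l := funext (muPiece_apply l)
    rw [hp, ccat_eq_flatten, ← List.map_map, map_listFn_range, flatten_map_ite_unaryNat]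
  · intro j _
    rw [muPiece_apply]
    have := listFn_le_sum l j
    have := sum_le_length_wOf l
    split_ifs
    · simp
    · rw [length_unaryNat]; omega

/-! ### The conversion -/

/-- **The conversion `convF`**: on the code of a weakly decreasing composition `λ` with `3 ∣ |λ|`, the
partition code `unaryList (λ without zeros) ++ unaryNat (|λ|/3)`; otherwise the empty word.
[cite: FischerIkenmeyer2020, Lemma 4 (proof)] -/
def convF : List Bool → List Bool :=
  iteFn (andFn div3T antiT) (fun w => codeMuF w ++ (nF w ++ [false])) fun _ => []

/-- **`convF ∈ FP`**. [cite: AroraBarak2009, §1.3] -/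
theorem convF_mem_FP : convF ∈ FP :=
  iteFn_mem_FP (andFn_mem_FP div3T_mem_FP antiT_mem_FP)
    (append_mem_FP codeMuF_mem_FP (append_mem_FP nF_mem_FP (const_mem_FP _))) (const_mem_FP _)

/-- **Value of `convF` on a composition code.** [cite: FischerIkenmeyer2020, Lemma 4 (proof)] -/
theorem convF_encode (l : List ℕ) :
    convF (encodingComposition.encode l) =
      if 3 ∣ l.sum ∧ AntiL l then unaryList (l.filter (· ≠ 0)) ++ unaryNat (l.sum / 3) else [] := by
  change convF (wOf l) = _
  rw [convF, iteFn_apply (andFn_apply (div3T_wOf l) (antiT_wOf l))]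
  by_cases h3 : 3 ∣ l.sum
  · by_cases ha : AntiL l
    · rw [decide_eq_true h3, decide_eq_true ha, Bool.true_and, if_pos rfl, if_pos ⟨h3, ha⟩, codeMuF_wOf,
        nF_wOf h3, unaryNat]
    · rw [decide_eq_false ha, Bool.and_false, if_neg (by decide), if_neg (fun h => ha h.2)]
  · rw [decide_eq_false h3, Bool.false_and, if_neg (by decide), if_neg (fun h => h3 h.1)]

end PlethCode

end Literature.Barriers.ValiantsHypothesis
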